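import Summits.ResolutionOfSingularities.ResolutionOfSingularities.Theorems.HomologicalConductorNoZenoCurveIntersectionFinite
import Literature.AlgebraicGeometry.Resolution.StalkSpecializesLocalization
import Literature.AlgebraicGeometry.Resolution.ExceptionalCurveDegree
import Literature.AlgebraicGeometry.Resolution.QuasiExcellentCurveDelta
import Literature.AlgebraicGeometry.Resolution.QuadraticTransformsUFD
import Literature.AlgebraicGeometry.Resolution.RegularLocalRingsProofs
import Literature.AlgebraicGeometry.Resolution.ExcellentRingsFieldProofs
import Literature.AlgebraicGeometry.Motives.ClosedSubvarietyOfPoint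
import Literature.AlgebraicGeometry.Motives.CartierDivisorIntersectionCycle
import HarnessLib

/-!
# Crux `NoZenoR` (stmt-ResolutionOfSingularities-19943), β layer — `sepNodes_finite` (PREP v2.1 §2.1 D2):
# the κ^sep-node set of the exceptional fibre of a proper `X → Spec R` with finitely many exceptional curves is FINITE

Route `ResolutionOfSingularities/HomologicalConductor`, crux chain W4.4.  OURS (cell res-hironaka; planner res-L0-w44-plan-1
CHAIN §2 row o5 «`sepNodes_finite`», lead census B1-CENSUS-g8 «downstairs (B2) … `sepNodes_finite` (o5)»); AI-written, weaker than
expert review; nothing of the manuscript under review (Hironaka 2017) is used and no Theses declaration is asserted.  Def-free,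
`--supports 19943 --as helper`.

The decomposition (STATUS 15:38:07Z): `sepNodes π ⊆ ⋃_{η ≠ η′} (cl η ∩ cl η′) ∪ ⋃_η Sing(E_η)`, `E_η = closure {η}` reduced.

* (i) VALUATION PIECE.  If the reduced curve germ `G = curveGerm z η h ⊆ κ(η)` (the image of `𝒪_{X,z} → κ(η)`) satisfies
  «`x ∈ G ∨ x⁻¹ ∈ G` for all `x ∈ κ(η)`» (it is a valuation ring of `κ(η)`), then every branch `V` of `E_η` at `z`
  (`IsBranchAt`: a proper valuation ring dominating `G`) IS `G` (`toSubring_eq_curveGerm_of_forall_mem_or_inv_mem`), and its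
  separable residue degree over `κ(z)` is `1` (`branchSepDegree_eq_one_of_forall_mem_or_inv_mem`: `𝒪_{X,z} → V` is onto, so
  `κ(z) → κ(V)` is onto).  Hence (`sepNodes_subset`) a node lies on two distinct exceptional curves or at a point where some germ
  fails the dichotomy.
* (ii) REGULARITY PIECE.  `𝒪_{X,η}` is the localisation of `𝒪_{X,z}` at `𝔭_η` (tree `isLocalizationAtPrime_stalkSpecializes`,
  Stacks 01J7), so every element of `κ(η)` is a quotient of two elements of `G`; the local ring of the integral curve
  `E_η = ClosedSubvariety.ofPoint X η` at the point over `z` is `𝒪_{X,z}/𝔭_η` (tree `ker_stalkMap_ofPoint_ι`); if it is REGULAR it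
  is a regular local ring of dimension `≤ 1`, a principal ideal domain, a valuation ring, and the dichotomy holds
  (`forall_mem_or_inv_mem_of_mem_regularLocus`).  The non-regular locus of `E_η` is finite
  (`finite_compl_regularLocus_ofPoint`): `E_η` is proper over the residue FIELD `κ(𝔪)` (tree `exists_fac_specResidueField`), hence
  quasi-excellent (fields are J-2: tree `Stacks07QW_field_holds`, `FieldsJ2`), its regular locus is open
  (`Scheme.isOpen_regularLocus_of_isQuasiExcellent`) and contains the generic point, and a proper closed subset of a
  one-dimensional irreducible Noetherian space is finite (`Set.finite_and_isClosed_singleton_of_dim_le_one`).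
* (iii) two distinct exceptional curves meet in finitely many points — `finite_closure_inter_closure_of_mem_excCurvePoints`
  (sibling file `…NoZenoCurveIntersectionFinite`).

Main statements: `sepNodes_finite (π : X ⟶ Spec R) [IsProper π] (hfin : (excCurvePoints π).Finite) : (sepNodes π).Finite`;
`isClosed_singleton_of_mem_sepNodes` (nodes are CLOSED points: a node is a proper specialisation of its curve — `not_isBranchAt_self`),
`isClosed_sepNodes`, `closure_sepNodes_eq` (the blow-up centre `closure (sepNodes π)` is the finite node set itself)
(`R` Noetherian local; no resolution / normality / dimension hypothesis is needed — `hfin` is the conjunct every consumer holds).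

References: J. Lipman, Publ. Math. IHÉS 36 (1969) §16 (16.1) p. 231 (branches of the exceptional curves; context)
[`Lipman1969`]; The Stacks Project, Tags 01J7, 07P6, 0BA8 [`StacksProject`]; H. Matsumura, *Commutative Ring Theory* §30 Cor. to
Thm. 30.5, §32 p. 260 [`Matsumura1987`].
-/

-- single-problem summit: the doubled namespace component `ResolutionOfSingularities` is forced
set_option linter.dupNamespace false

noncomputable section

namespace Summit.ResolutionOfSingularities.ResolutionOfSingularities.Theorems.NoZeno.ExcCount

open CategoryTheory AlgebraicGeometry TopologicalSpace IsLocalRing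
open Literature.AlgebraicGeometry.Resolution Literature.AlgebraicGeometry.Motives

universe u

/-! ## (i) The valuation piece: branches at a point where the curve germ is a valuation ring -/

section Valuation

variable {X : Scheme.{0}} {z η : X} (h : η ⤳ z)

/-- **A branch at a point whose curve germ is a valuation ring is the germ itself.**  If every `x ∈ κ(η)` has `x ∈ G` or
`x⁻¹ ∈ G`, `G = curveGerm z η h`, then a valuation ring `V` of `κ(η)` dominating `G` (`IsBranchAt`) has `V = G` as subrings:
for `x ∈ V` with `x⁻¹ ∈ G`, the element `x⁻¹ ∈ G` is invertible in `V`, hence in `G` (domination), so `x ∈ G`.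
[cite: Lipman1969, §16 (16.1) (p. 231)] -/
theorem toSubring_eq_curveGerm_of_forall_mem_or_inv_mem
    (hW : ∀ x : X.residueField η, x ∈ curveGerm z η h ∨ x⁻¹ ∈ curveGerm z η h)
    {V : ValuationSubring (X.residueField η)} (hb : IsBranchAt z η h V) :
    V.toSubring = curveGerm z η h := by
  refine le_antisymm (fun x hx => ?_) hb.2.1
  rcases hW x with hxG | hxG
  · exact hxG
  · by_cases hx0 : x = 0
    · rw [hx0]; exact zero_mem _
    · have hxx : x⁻¹⁻¹ ∈ V.toSubring := by rw [inv_inv]; exact hx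
      have := hb.2.2 x⁻¹ hxG hxx
      rwa [inv_inv] at this

/-- Under the same dichotomy, the local structure map `𝒪_{X,z} → V` of a branch is SURJECTIVE (its image is the germ, which
is all of `V`). [this work] -/
theorem toBranch_surjective_of_forall_mem_or_inv_mem
    (hW : ∀ x : X.residueField η, x ∈ curveGerm z η h ∨ x⁻¹ ∈ curveGerm z η h)
    {V : ValuationSubring (X.residueField η)} (hb : IsBranchAt z η h V) :
    Function.Surjective (toBranch z η h V hb) := by
  intro v
  have hv : (v : X.residueField η) ∈ curveGerm z η h := by
    rw [← toSubring_eq_curveGerm_of_forall_mem_or_inv_mem h hW hb]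
    exact v.2
  obtain ⟨s, hs⟩ := hv
  exact ⟨s, Subtype.ext hs⟩

/-- **At a point whose curve germ is a valuation ring every branch has separable residue degree `1`**: the local structure
map `𝒪_{X,z} → V` is onto, so `κ(z) → κ(V)` is onto, `κ(V) = κ(z)` and the separable closure of `κ(z)` in `κ(V)` is `κ(z)`
itself. [cite: Lipman1969, §16 (16.1), (16.5) (pp. 231–235)] -/
theorem branchSepDegree_eq_one_of_forall_mem_or_inv_mem
    (hW : ∀ x : X.residueField η, x ∈ curveGerm z η h ∨ x⁻¹ ∈ curveGerm z η h)
    {V : ValuationSubring (X.residueField η)} (hb : IsBranchAt z η h V) :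
    branchSepDegree z η h V hb = 1 := by
  unfold branchSepDegree
  letI := isLocalHom_toBranch z η h V hb
  letI : Algebra (X.residueField z) (IsLocalRing.ResidueField V) :=
    (IsLocalRing.ResidueField.map (toBranch z η h V hb)).toAlgebra
  -- `κ(z) → κ(V)` is surjective
  have hsurj : Function.Surjective (algebraMap (X.residueField z) (IsLocalRing.ResidueField V)) := by
    intro y
    obtain ⟨v, rfl⟩ := IsLocalRing.residue_surjective y
    obtain ⟨s, rfl⟩ := toBranch_surjective_of_forall_mem_or_inv_mem h hW hb v
    exact ⟨IsLocalRing.residue _ s, (IsLocalRing.ResidueField.map_residue _ s)⟩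
  have hbot : separableClosure (X.residueField z) (IsLocalRing.ResidueField V) = ⊥ :=
    eq_bot_iff.mpr fun x _ => IntermediateField.mem_bot.mpr (hsurj x)
  rw [hbot, IntermediateField.finrank_bot]

end Valuation

/-! ## (ii-a) Algebra: the dichotomy from a valuation-ring quotient and a denominator property -/

section Algebra

/-- **Transfer of the valuation dichotomy.**  Let `g : O → K` (a field) and `f : O → B` be ring maps with `f` surjective,
`ker f ≤ ker g` and `B` a (pre)valuation ring; assume every `x ∈ K` can be written `x · g s = g a` with `g s ≠ 0`.  Then every
`x ∈ K` has `x ∈ g(O)` or `x⁻¹ ∈ g(O)`. [folklore] -/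
theorem mem_range_or_inv_mem_range_of_preValuationRing {O B K : Type*} [CommRing O] [CommRing B] [Field K]
    [PreValuationRing B] (g : O →+* K) (f : O →+* B) (hf : Function.Surjective f)
    (hker : RingHom.ker f ≤ RingHom.ker g)
    (hsurj : ∀ x : K, ∃ a s : O, g s ≠ 0 ∧ x * g s = g a) (x : K) :
    x ∈ g.range ∨ x⁻¹ ∈ g.range := by
  obtain ⟨a, s, hs, hx⟩ := hsurj x
  obtain ⟨c', hc'⟩ := PreValuationRing.cond (f a) (f s)
  obtain ⟨c, rfl⟩ := hf c'
  -- transport an equation modulo `ker f` to `K`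
  have key : ∀ p q : O, f p = f q → g p = g q := fun p q hpq => by
    have hmem : p - q ∈ RingHom.ker g := hker (by rw [RingHom.mem_ker, map_sub, hpq, sub_self])
    rwa [RingHom.mem_ker, map_sub, sub_eq_zero] at hmem
  rcases hc' with hac | hsc
  · -- `a c ≡ s`: then `g a ≠ 0` and `x⁻¹ = g c`
    have hgs : g a * g c = g s := by rw [← map_mul]; exact key _ _ (by rw [map_mul, hac])
    have hga : g a ≠ 0 := fun h0 => hs (by rw [← hgs, h0, zero_mul])
    right
    refine ⟨c, ?_⟩
    have hx' : x = g a * (g s)⁻¹ := by rw [← hx, mul_inv_cancel_right₀ hs]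
    rw [hx', mul_inv, inv_inv, ← hgs]
    field_simp
  · -- `s c ≡ a`: then `x = g c`
    have hga : g s * g c = g a := by rw [← map_mul]; exact key _ _ (by rw [map_mul, hsc])
    left
    refine ⟨c, ?_⟩
    have : x * g s = g c * g s := by rw [hx, ← hga, mul_comm]
    exact (mul_right_cancel₀ hs this).symm

end Algebra

/-! ## (ii-b) Every element of `κ(η)` is a fraction of two elements of the curve germ -/

section Stalks

variable {X : Scheme.{0}} {z η : X} (h : η ⤳ z)

/-- **Denominators from `𝒪_{X,z}`.**  For a specialisation `η ⤳ z`, with `g : 𝒪_{X,z} → 𝒪_{X,η} → κ(η)`: every `x ∈ κ(η)`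
satisfies `x · g s = g a` for some `a, s ∈ 𝒪_{X,z}` with `g s ≠ 0` — `𝒪_{X,η}` is the localisation of `𝒪_{X,z}` at
`𝔭_η = g⁻¹(0)` (tree `isLocalizationAtPrime_stalkSpecializes`, Stacks 01J7) and `𝒪_{X,η} → κ(η)` is onto.
[cite: StacksProject, Tag 01J7] -/
theorem exists_mul_eq_of_residue_stalkSpecializes (x : X.residueField η) :
    ∃ a s : X.presheaf.stalk z,
      ((X.residue η).hom.comp (X.presheaf.stalkSpecializes h).hom) s ≠ 0 ∧
        x * ((X.residue η).hom.comp (X.presheaf.stalkSpecializes h).hom) s =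
          ((X.residue η).hom.comp (X.presheaf.stalkSpecializes h).hom) a := by
  letI := (X.presheaf.stalkSpecializes h).hom.toAlgebra
  haveI := isLocalizationAtPrime_stalkSpecializes h
  obtain ⟨y, rfl⟩ := X.residue_surjective η x
  obtain ⟨⟨a, s⟩, hy⟩ := IsLocalization.surj
    ((maximalIdeal (X.presheaf.stalk η)).comap (X.presheaf.stalkSpecializes h).hom).primeCompl y
  refine ⟨a, s, ?_, ?_⟩
  · -- `s ∉ 𝔭_η`, i.e. its image in `𝒪_{X,η}` is a unit
    intro h0
    apply s.2
    change (X.presheaf.stalkSpecializes h).hom s ∈ maximalIdeal (X.presheaf.stalk η)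
    rw [← IsLocalRing.residue_eq_zero_iff]
    exact h0
  · change X.residue η y * X.residue η (algebraMap _ _ (s : X.presheaf.stalk z)) =
      X.residue η (algebraMap _ _ a)
    rw [← map_mul, hy]

end Stalks

/-! ## (ii-c) Regular points of the integral curve `E_η = closure {η}` satisfy the dichotomy -/

section Regular

variable {X : Scheme.{0}} {η : X}

/-- The integral curve `E_η = ClosedSubvariety.ofPoint X η` through a point `η` of height `≤ 1` has topological dimension
`≤ 1` (its dimension is the height of its generic point `η`). [folklore] -/
theorem topologicalKrullDim_ofPoint_le_one (hη : Order.height η ≤ 1) :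
    topologicalKrullDim (ClosedSubvariety.ofPoint X η).carrier ≤ 1 := by
  rw [show topologicalKrullDim (ClosedSubvariety.ofPoint X η).carrier =
      Order.krullDim (ClosedSubvariety.ofPoint X η).carrier from
    Order.krullDim_eq_of_orderIso (irreducibleSetEquivPoints (α := (ClosedSubvariety.ofPoint X η).carrier)),
    ← Order.height_top_eq_krullDim, height_top_ofPoint]
  exact_mod_cast hη

/-- **A regular point of the reduced exceptional curve has a valuation-ring germ.**  Let `v` be a point of the integral curve
`E_η = ClosedSubvariety.ofPoint X η` (`η` of height `≤ 1`) over `z ∈ X`, with `𝒪_{E_η,v}` a regular local ring.  Then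
`𝒪_{E_η,v} = 𝒪_{X,z}/𝔭_η` (tree `ker_stalkMap_ofPoint_ι`) is regular of dimension `≤ 1`, hence a principal ideal domain and
a valuation ring, and — `κ(η)` being the fraction field of the germ (`exists_mul_eq_of_residue_stalkSpecializes`) — every
`x ∈ κ(η)` lies in the curve germ `curveGerm z η h` or has its inverse there. [cite: StacksProject, Tag 01J7] -/
theorem forall_mem_or_inv_mem_of_mem_regularLocus (hη : Order.height η ≤ 1)
    (v : (ClosedSubvariety.ofPoint X η).carrier)
    (hv : v ∈ Scheme.regularLocus (ClosedSubvariety.ofPoint X η).carrier) {z : X} (h : η ⤳ z)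
    (hz : (ClosedSubvariety.ofPoint X η).ι v = z) (x : X.residueField η) :
    x ∈ curveGerm z η h ∨ x⁻¹ ∈ curveGerm z η h := by
  subst hz
  haveI : IsRegularLocalRing ((ClosedSubvariety.ofPoint X η).carrier.presheaf.stalk v) :=
    (Scheme.mem_regularLocus v).mp hv
  have hdim : ringKrullDim ((ClosedSubvariety.ofPoint X η).carrier.presheaf.stalk v) ≤ 1 :=
    ringKrullDim_stalk_le_one (topologicalKrullDim_ofPoint_le_one hη) v
  haveI : IsDomain ((ClosedSubvariety.ofPoint X η).carrier.presheaf.stalk v) := isDomain_of_isRegularLocalRing _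
  haveI : IsPrincipalIdealRing ((ClosedSubvariety.ofPoint X η).carrier.presheaf.stalk v) :=
    isPrincipalIdealRing_of_ringKrullDim_le_one hdim
  haveI : ValuationRing ((ClosedSubvariety.ofPoint X η).carrier.presheaf.stalk v) := inferInstance
  -- `ker (𝒪_{X,z} → 𝒪_{E,v}) = 𝔭_η ≤ ker (𝒪_{X,z} → κ(η))`
  have hker : RingHom.ker ((ClosedSubvariety.ofPoint X η).ι.stalkMap v).hom ≤
      RingHom.ker ((X.residue η).hom.comp (X.presheaf.stalkSpecializes h).hom) := by
    rw [ClosedSubvariety.ker_stalkMap_ofPoint_ι]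
    intro a ha
    rw [RingHom.mem_ker, RingHom.comp_apply]
    exact (IsLocalRing.residue_eq_zero_iff _).mpr ha
  exact mem_range_or_inv_mem_range_of_preValuationRing
    ((X.residue η).hom.comp (X.presheaf.stalkSpecializes h).hom) ((ClosedSubvariety.ofPoint X η).ι.stalkMap v).hom
    (((ClosedSubvariety.ofPoint X η).ι).stalkMap_surjective v) hker (exists_mul_eq_of_residue_stalkSpecializes h) x

end Regular

/-! ## (ii-d) The non-regular locus of an integral exceptional curve is finite -/

section Singular

variable {R : Type} [CommRing R] [IsLocalRing R] [IsNoetherianRing R] {X : Scheme.{0}}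
  (π : X ⟶ Spec (.of R)) [IsProper π]

/-- **An integral exceptional curve has finitely many non-regular points.**  For `η ∈ excCurvePoints π` (`π : X → Spec R`
proper, `R` Noetherian local), the integral curve `E_η = closure {η}` is proper over the residue FIELD `κ(𝔪)` (tree
`exists_fac_specResidueField`), hence quasi-excellent (finite type algebras over a field are excellent — tree
`Stacks07QW_field_holds`, fields are J-2); so its regular locus is open (`Scheme.isOpen_regularLocus_of_isQuasiExcellent`),
non-empty (generic point), and its complement — a proper closed subset of a one-dimensional irreducible Noetherian space —
is finite. [cite: Matsumura1987, §30, Cor. to Thm. 30.5] -/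
theorem finite_compl_regularLocus_ofPoint {η : X} (hη : η ∈ excCurvePoints π) :
    (Scheme.regularLocus (ClosedSubvariety.ofPoint X η).carrier)ᶜ.Finite := by
  set E := ClosedSubvariety.ofPoint X η with hE
  obtain ⟨q, hq⟩ := exists_fac_specResidueField π hη.1
  haveI : IsProper q := isProper_of_fac_specResidueField π hq
  have hqe : Scheme.IsQuasiExcellent E.carrier :=
    Scheme.isQuasiExcellent_of_locallyOfFiniteType Stacks07QW_field_holds q
  haveI : IsLocallyNoetherian X := LocallyOfFiniteType.isLocallyNoetherian π
  haveI : CompactSpace X := QuasiCompact.compactSpace_of_compactSpace π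
  haveI : CompactSpace E.carrier := QuasiCompact.compactSpace_of_compactSpace E.ι
  haveI : IsNoetherian E.carrier := {}
  have hdim : topologicalKrullDim E.carrier ≤ 1 := topologicalKrullDim_ofPoint_le_one hη.2.le
  have hclosed : IsClosed (Scheme.regularLocus E.carrier)ᶜ :=
    (Scheme.isOpen_regularLocus_of_isQuasiExcellent hqe).isClosed_compl
  have hne : (Scheme.regularLocus E.carrier)ᶜ ≠ Set.univ := fun hu => by
    have hmem : genericPoint E.carrier ∈ (Scheme.regularLocus E.carrier)ᶜ := hu ▸ Set.mem_univ _
    exact hmem (genericPoint_mem_regularLocus E.carrier)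
  exact (Set.finite_and_isClosed_singleton_of_dim_le_one hdim hclosed hne).1

end Singular

/-! ## Assembly -/

section Assembly

variable {R : Type} [CommRing R] [IsLocalRing R] {X : Scheme.{0}} (π : X ⟶ Spec (.of R))

/-- **Where the nodes are.**  A κ^sep-node of the exceptional fibre lies on two DISTINCT integral exceptional curves, or on
one exceptional curve `E_η` at a point where the curve germ fails the valuation dichotomy «`x ∈ G ∨ x⁻¹ ∈ G`» (at points where
it holds there is exactly one branch, the germ, of separable residue degree `1` — the valuation piece).
[cite: Lipman1969, §16 (16.1) (p. 231)] -/
theorem sepNodes_subset :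
    sepNodes π ⊆
      (⋃ η ∈ excCurvePoints π, ⋃ η' ∈ excCurvePoints π,
          {z | η ≠ η' ∧ z ∈ closure ({η} : Set X) ∩ closure {η'}}) ∪
        ⋃ η ∈ excCurvePoints π,
          {z | ∃ h : η ⤳ z, ¬ ∀ x : X.residueField η, x ∈ curveGerm z η h ∨ x⁻¹ ∈ curveGerm z η h} := by
  intro z hz
  obtain ⟨-, hz⟩ := (mem_sepNodes_iff π z).mp hz
  rcases hz with ⟨⟨η, V⟩, ⟨η', V'⟩, hne, ⟨hη, h, hb⟩, ⟨hη', h', hb'⟩⟩ | ⟨η, h, V, hb, hη, h2⟩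
  · dsimp only at hη h hb hη' h' hb'
    by_cases hηη : η = η'
    · subst hηη
      -- one curve, two distinct branches at `z`: the germ fails the dichotomy
      refine Or.inr (Set.mem_biUnion hη ⟨h, fun hW => hne ?_⟩)
      have hV : V.toSubring = curveGerm z η h := toSubring_eq_curveGerm_of_forall_mem_or_inv_mem h hW hb
      have hV' : V'.toSubring = curveGerm z η h := toSubring_eq_curveGerm_of_forall_mem_or_inv_mem h' hW hb'
      have hVV : V = V' := ValuationSubring.toSubring_injective (hV.trans hV'.symm)
      rw [hVV]
    · exact Or.inl (Set.mem_biUnion hη (Set.mem_biUnion hη' ⟨hηη, h.mem_closure, h'.mem_closure⟩))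
  · refine Or.inr (Set.mem_biUnion hη ⟨h, fun hW => ?_⟩)
    have h1 := branchSepDegree_eq_one_of_forall_mem_or_inv_mem h hW hb
    omega

/-- **`sepNodes_finite`**: for a proper `π : X → Spec R` (`R` Noetherian local) with finitely many integral exceptional curves,
the κ^sep-node set `sepNodes π` (points of the closed fibre carrying two geometric branches of the exceptional curve) is
FINITE — it lies in the union of the finitely many pairwise intersections of distinct exceptional curves (piece (iii),
`finite_closure_inter_closure_of_mem_excCurvePoints`) and of the finitely many non-regular points of each reduced exceptional
curve (pieces (i)–(ii)).  Sub-debt D2 of the (B2) descent of slot 5 (`stub_L1wCoreF`), PREP v2.1 §2.1.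
[cite: Lipman1969, §16 (16.1) (p. 231)] -/
theorem sepNodes_finite [IsNoetherianRing R] [IsProper π] (hfin : (excCurvePoints π).Finite) :
    (sepNodes π).Finite := by
  refine Set.Finite.subset (Set.Finite.union ?_ ?_) (sepNodes_subset π)
  · refine hfin.biUnion fun η hη => hfin.biUnion fun η' hη' => ?_
    by_cases hne : η = η'
    · exact Set.finite_empty.subset fun z hz => (hz.1 hne).elim
    · exact (finite_closure_inter_closure_of_mem_excCurvePoints π hη hη' hne).subset fun z hz => hz.2
  · refine hfin.biUnion fun η hη => ?_
    refine ((finite_compl_regularLocus_ofPoint π hη).image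
      fun v => (ClosedSubvariety.ofPoint X η).ι v).subset ?_
    rintro z ⟨h, hW⟩
    exact ⟨ClosedSubvariety.ofPointPt η h, fun hv => hW
      (forall_mem_or_inv_mem_of_mem_regularLocus hη.2.le _ hv h (ClosedSubvariety.ofPoint_ι_ofPointPt η h)),
      ClosedSubvariety.ofPoint_ι_ofPointPt η h⟩

end Assembly

/-! ## The node set is a finite set of CLOSED points (so `closure (sepNodes π) = sepNodes π`) -/

section Closed

variable {X : Scheme.{0}}

/-- **No branch at the generic point itself**: the curve germ `curveGerm η η h` is all of `κ(η)` (`𝒪_{X,η} → κ(η)` is onto and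
`stalkSpecializes (η ⤳ η)` is the identity), so a valuation ring dominating it is `⊤`, which `IsBranchAt` excludes. [folklore] -/
theorem not_isBranchAt_self (η : X) (h : η ⤳ η) (V : ValuationSubring (X.residueField η)) : ¬ IsBranchAt η η h V := by
  rintro ⟨hV, hdom⟩
  apply hV
  have hs : X.presheaf.stalkSpecializes h = 𝟙 _ := X.presheaf.stalkSpecializes_refl η
  refine ValuationSubring.toSubring_injective ?_
  refine le_antisymm le_top fun x _ => hdom.1 ?_
  obtain ⟨y, rfl⟩ := X.residue_surjective η x
  refine ⟨y, ?_⟩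
  rw [RingHom.comp_apply, hs]
  rfl

/-- A point carrying a branch of `E_η` is not `η`. [folklore] -/
theorem ne_of_isBranchAt {z η : X} (h : η ⤳ z) {V : ValuationSubring (X.residueField η)} (hb : IsBranchAt z η h V) : z ≠ η := by
  rintro rfl
  exact not_isBranchAt_self z h V hb

variable {R : Type} [CommRing R] [IsLocalRing R] (π : X ⟶ Spec (.of R))

/-- **A node has height `0`**: it carries a branch of some integral exceptional curve `E_η` (`η` of height `1`) and is a PROPER
specialisation of `η` (`ne_of_isBranchAt`). [cite: Lipman1969, §16 (16.1) (p. 231)] -/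
theorem height_eq_zero_of_mem_sepNodes {z : X} (hz : z ∈ sepNodes π) : Order.height z = 0 := by
  -- a curve `η ∈ excCurvePoints π` and a branch of it at `z`
  obtain ⟨η, h, hη, hne⟩ : ∃ (η : X) (_ : η ⤳ z), η ∈ excCurvePoints π ∧ z ≠ η := by
    obtain ⟨-, hz⟩ := (mem_sepNodes_iff π z).mp hz
    rcases hz with ⟨⟨η, V⟩, -, -, ⟨hη, h, hb⟩, -⟩ | ⟨η, h, V, hb, hη, -⟩
    · exact ⟨η, h, hη, ne_of_isBranchAt h hb⟩
    · exact ⟨η, h, hη, ne_of_isBranchAt h hb⟩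
  -- `z < η` in the specialisation order, so `height z < height η = 1`
  have hlt : z < η := lt_iff_le_not_ge.mpr ⟨Scheme.le_iff_specializes.mpr h, fun hge =>
    hne ((Scheme.le_iff_specializes.mp hge).antisymm h).eq⟩
  have h1 : Order.height z < Order.height η :=
    Order.height_strictMono hlt (lt_of_le_of_lt (Order.height_mono hlt.le) (by rw [hη.2]; exact ENat.coe_lt_top 1))
  rw [hη.2] at h1
  by_contra h0
  exact (not_lt.mpr (Order.one_le_iff_ne_zero.mpr h0)) h1

/-- **Nodes are closed points.** [cite: Lipman1969, §16 (16.1) (p. 231)] -/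
theorem isClosed_singleton_of_mem_sepNodes {z : X} (hz : z ∈ sepNodes π) : IsClosed ({z} : Set X) := by
  have hmin : IsMin z := Order.height_eq_zero.mp (height_eq_zero_of_mem_sepNodes π hz)
  refine isClosed_of_closure_subset fun y hy => ?_
  have hzy : z ⤳ y := specializes_iff_mem_closure.mpr hy
  have hyz : y ⤳ z := Scheme.le_iff_specializes.mp (hmin (Scheme.le_iff_specializes.mpr hzy))
  exact (hyz.antisymm hzy).eq

/-- **The node set is closed** (a finite union of closed points; `π` proper over a Noetherian local `R` with finitely many exceptional
curves). [this work] -/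
theorem isClosed_sepNodes [IsNoetherianRing R] [IsProper π] (hfin : (excCurvePoints π).Finite) : IsClosed (sepNodes π) := by
  rw [← Set.biUnion_of_singleton (sepNodes π)]
  exact (sepNodes_finite π hfin).isClosed_biUnion fun z hz => isClosed_singleton_of_mem_sepNodes π hz

/-- Hence the centre `closure (sepNodes π)` of the X¹-sandwich blow-up (`IsSepX1Sandwiched`) IS the finite node set.
[this work] -/
theorem closure_sepNodes_eq [IsNoetherianRing R] [IsProper π] (hfin : (excCurvePoints π).Finite) :
    closure (sepNodes π) = sepNodes π :=
  (isClosed_sepNodes π hfin).closure_eq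

end Closed

end Summit.ResolutionOfSingularities.ResolutionOfSingularities.Theorems.NoZeno.ExcCount

end
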